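import Summits.AtomisticToContinuum.Crystallization.Theorems.OverbindingBudgetAffineCompressedCutOffDisc

/-!
# Overbinding budget — compressed cut: R4 «LR(r₁)» III — AXIS-CENTRED PATCHES (one layer up or down on a box)

Record: route `OverbindingBudget`, crux `RobustDefectLimitWindows` (stmt-AtomisticToContinuum-31280); open leaf NS♭₂ ⟸ 79K ⟸ LR(r₁); R4 «LR(r₁)».
This file REPLACES the disc bookkeeping of `…Run.stack_run` (regular hexagons of integer hex radius about a drifting reference label: the inradius
about `i`'s fixed column falls by `0.866` (+ drift `0.577`) nn per level, which cannot cover `B(y_i, 4.24·nn_i)` inside the `12·nn_i` ball — lens-4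
FINDING of GEN 81) by AXIS-CENTRED BOX PATCHES.

* §0 box arithmetic.  `InBox o K x :⟺ |x_c + o_c| ≤ K` for the three coordinates (an axis-centred semi-regular hexagon of the layer lattice when
  `o` is the offset of the reference label from the column); `capv s ε δ = s·(2,2,2) + ε·δ`; `dL` = the three sum-zero vectors `(1,1,−2)`-type: the
  caps of every aligned copy on either side are `capv sg ε δ, δ ∈ dL` for one sign `ε` (`cap_shape`); label identities.
* §1 ★ `climb_point` — the body of `…StackTwo.layer_climb` for two EXPLICIT parents at labels `p`, `p + e₀` and the child at `p + c₀` (same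
  inputs, same three resolution inequalities, ROOM at the child only).
* §2 `cap_pairs` — for every pair of distinct caps `c_a, c_b` of one side: `c_a − c_b ∈ hexL` and an in-plane `a ∈ hexL` adjacent to `c_a` and to
  `c_a − c_b` with `tdet ≠ 0` (the inputs of `climb_point`), by `decide`.
* §3 ★★ `layer_climb_box` — parents established on the box `InBox o K` (`K ≥ 2`) of one layer on one aligned copy ⟹ children established on the
  box `InBox (o + ε·(1,1,−2)) (K − 1)` of the adjacent layer at labels `λ₀ + capv sg ε (1,1,−2) + x`: EDGE-SUPPORTED growth — a child needs only
  the two parents below one edge, and the union of the three cap-pair regions contains the box one unit smaller (at most one child coordinate can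
  reach `±(K − 1)`), so the inradius about the column falls by `1/(2√3) = 0.2887` nn per level with NO drift.

Deps: `…CompressedCutOffDisc` (hence `…Run`, `…StackTwo`).  No `instance`, no `notation`, no `set_option`, no new axioms, 0 sorry.
-/

namespace Summit.AtomisticToContinuum.Crystallization.Theorems.OverbindingBudgetAffineCompressedCutPatch

open Literature.Geometry.DiscreteGeometry (nearestDist nearestDist_nonneg fccTwoShellPattern hcpTwoShellPattern)
open Summit.AtomisticToContinuum.Crystallization.Theorems.OverbindingBudgetAffineCompressedCutKernel (T3 tsub tadd tsq thsum tdet fccL hcpL fccNegL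
  hcpAltL hexL capL kernelOneB kernelTwoB)
open Summit.AtomisticToContinuum.Crystallization.Theorems.OverbindingBudgetAffineCompressedCutCharts (mv ListedBy)
open Summit.AtomisticToContinuum.Crystallization.Theorems.OverbindingBudgetAffineCompressedCutEstablish (Estab copies_separated link_nonneg)
open Summit.AtomisticToContinuum.Crystallization.Theorems.OverbindingBudgetAffineCompressedCutEstablishTwo (estab_child_two)
open Summit.AtomisticToContinuum.Crystallization.Theorems.OverbindingBudgetAffineCompressedCutSeed (InLayer lnorm hexL_facts estab_mono)
open Summit.AtomisticToContinuum.Crystallization.Theorems.OverbindingBudgetAffineCompressedCutStack (inLayer_tadd)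
open Summit.AtomisticToContinuum.Crystallization.Theorems.OverbindingBudgetAffineCompressedCutStackTwo (copies_basic)
open Summit.AtomisticToContinuum.Crystallization.Theorems.OverbindingBudgetAffineCompressedCutRun (tsub_tadd_self)
open Summit.AtomisticToContinuum.Crystallization.Theorems.OverbindingBudgetAffineCompressedCutOffDisc (abs_le_of_lnorm_le lnorm_le_of_abs_le)

variable {N : ℕ}

/-! ## §0  Box arithmetic -/

/-- **Axis-centred box.**  `x` (a layer vector relative to the reference label) lies in the box of size `K` about the column when every coordinate of
`x + o` has absolute value `≤ K`; `o` is the (integer, sum-zero) offset of the reference label from the column. [this file] -/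
def InBox (o : T3) (K : ℤ) (x : T3) : Prop := |x.1 + o.1| ≤ K ∧ |x.2.1 + o.2.1| ≤ K ∧ |x.2.2 + o.2.2| ≤ K

/-- `capv s ε δ = s·(2,2,2) + ε·δ` — a cap vector (`s = ±1`, `δ ∈ dL`) or, with `s = 0`, the offset increment `ε·δ`. [this file] -/
def capv (s ε : ℤ) (δ : T3) : T3 := (2 * s + ε * δ.1, 2 * s + ε * δ.2.1, 2 * s + ε * δ.2.2)

/-- The three horizontal parts of the caps of one side: `(1,1,−2)` and its permutations. [this file] -/
def dL : List T3 := [(1, 1, -2), (1, -2, 1), (-2, 1, 1)]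

/-- A regular layer disc of hex radius `n` is the box of size `3n` with offset `0`. [this file] -/
theorem inBox_of_lnorm_le {x : T3} {n : ℤ} (hx : InLayer x) (h : lnorm x ≤ 6 * n) : InBox (0, 0, 0) (3 * n) x := by
  obtain ⟨h1, h2, h3⟩ := abs_le_of_lnorm_le hx.1 h
  exact ⟨by simpa using h1, by simpa using h2, by simpa using h3⟩

/-- Conversely the box of size `3n` with offset `0` is the regular disc of hex radius `n`. [this file] -/
theorem lnorm_le_of_inBox {x : T3} {n : ℤ} (hx : InLayer x) (h : InBox (0, 0, 0) (3 * n) x) : lnorm x ≤ 6 * n := by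
  obtain ⟨h1, h2, h3⟩ := h
  exact lnorm_le_of_abs_le hx.1 (by simpa using h1) (by simpa using h2) (by simpa using h3)

/-- Boxes grow with `K`. [this file] -/
theorem inBox_mono {o x : T3} {K K' : ℤ} (h : InBox o K x) (hK : K ≤ K') : InBox o K' x :=
  ⟨h.1.trans hK, h.2.1.trans hK, h.2.2.trans hK⟩

/-- The `capL`-side caps have `(1,1,−2)`-type horizontal parts: every `δ ∈ dL` sums to `0`, and `capv 0 ε δ` is a layer-lattice offset increment of
absolute coordinates `≤ 2` when `ε = ±1`. [this file] -/
theorem dL_facts : ∀ δ ∈ dL, δ.1 + δ.2.1 + δ.2.2 = 0 ∧ |δ.1| ≤ 2 ∧ |δ.2.1| ≤ 2 ∧ |δ.2.2| ≤ 2 := by decide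

/-- `thsum (capv s ε δ) = 6s` for `δ ∈ dL`. [this file] -/
theorem thsum_capv {s ε : ℤ} {δ : T3} (hδ : δ ∈ dL) : thsum (capv s ε δ) = 6 * s := by
  obtain ⟨h0, -⟩ := dL_facts δ hδ
  simp only [thsum, capv]
  have : ε * δ.1 + ε * δ.2.1 + ε * δ.2.2 = 0 := by rw [← mul_add, ← mul_add, h0, mul_zero]
  linarith

/-- `capv s ε δ = s·(2,2,2) + capv 0 ε δ`. [this file] -/
theorem capv_eq_tadd (s ε : ℤ) (δ : T3) : capv s ε δ = tadd (2 * s, 2 * s, 2 * s) (capv 0 ε δ) := by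
  simp only [capv, tadd, mul_zero, zero_add]

/-- Label identity: `(l + (x + (c − a))) + a = (l + c) + x`. [this file] -/
theorem tadd_tadd_tsub_cancel (l x c a : T3) : tadd (tadd l (tadd x (tsub c a))) a = tadd (tadd l c) x := by
  obtain ⟨l₁, l₂, l₃⟩ := l; obtain ⟨x₁, x₂, x₃⟩ := x; obtain ⟨c₁, c₂, c₃⟩ := c; obtain ⟨a₁, a₂, a₃⟩ := a
  simp only [tadd, tsub, Prod.mk.injEq]
  omega

/-- Label identity: `(l + z) + e = l + (z + e)`. [this file] -/
theorem tadd_tadd_assoc (l z e : T3) : tadd (tadd l z) e = tadd l (tadd z e) := by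
  obtain ⟨l₁, l₂, l₃⟩ := l; obtain ⟨z₁, z₂, z₃⟩ := z; obtain ⟨e₁, e₂, e₃⟩ := e
  simp only [tadd, Prod.mk.injEq]
  omega

/-- `a − (a − b) = b`. [this file] -/
theorem tsub_tsub_self (a b : T3) : tsub a (tsub a b) = b := by
  obtain ⟨a₁, a₂, a₃⟩ := a; obtain ⟨b₁, b₂, b₃⟩ := b
  simp only [tsub, Prod.mk.injEq]
  omega

/-- `(p + c) − (p + e) = c − e`. [this file] -/
theorem tsub_tadd_tadd_left (p c e : T3) : tsub (tadd p c) (tadd p e) = tsub c e := by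
  obtain ⟨p₁, p₂, p₃⟩ := p; obtain ⟨c₁, c₂, c₃⟩ := c; obtain ⟨e₁, e₂, e₃⟩ := e
  simp only [tsub, tadd, Prod.mk.injEq]
  omega

/-! ## §1  Climbing from two explicit parents -/

/-- ★ **POINT CLIMB.**  The body of `…StackTwo.layer_climb` for ONE child: ball data at base `i`; aligned copy `C` with its listing model `S₁`, the
in-layer one-parent row forcing `C`, the cap configuration `c₀, c₀ − e₀ ∈ capL C sg`, `e₀ ∈ hexL`, `a₀ ∈ C` adjacent to both with `tdet ≠ 0`, the
two-parent rows; parents established on `C` at labels `p` and `p + e₀` with bounds `τ, D` and scales in `[ν, ν′]`; the three resolution inequalities;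
ROOM at the child label `p + c₀`.  Output: the child established at `p + c₀`, bounds `τ⁺, D⁺`, scale in `[0.9967ν, 1.0011ν′]`, copy from the row of
its type. [this file] -/
theorem climb_point {y : Fin N → EuclideanSpace ℝ (Fin 3)} (hy : Function.Injective y) {r : ℝ} {i : Fin N}
    {A : Fin N → (EuclideanSpace ℝ (Fin 3) →ₗ[ℝ] EuclideanSpace ℝ (Fin 3))} {Qf : Fin N → (EuclideanSpace ℝ (Fin 3) →ₗᵢ[ℝ] EuclideanSpace ℝ (Fin 3))}
    {P : Fin N → Finset (EuclideanSpace ℝ (Fin 3))} {f : Fin N → EuclideanSpace ℝ (Fin 3) → EuclideanSpace ℝ (Fin 3)}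
    {B : EuclideanSpace ℝ (Fin 3) →ₗ[ℝ] EuclideanSpace ℝ (Fin 3)} {β : ℝ}
    (hP : ∀ j, dist (y j) (y i) ≤ r → (P j = fccTwoShellPattern ∨ P j = hcpTwoShellPattern))
    (hA : ∀ j, dist (y j) (y i) ≤ r → ∀ v ∈ P j, ‖A j v - Qf j v‖ ≤ 1 / 1000)
    (hf : ∀ j, dist (y j) (y i) ≤ r → ∀ v ∈ P j, f j v ∈ Set.range y ∧ dist (f j v) (y j + nearestDist y j • A j v) ≤ 1 / 10 ^ 4 * nearestDist y j)
    (hinj : ∀ j, dist (y j) (y i) ≤ r → Set.InjOn (f j) ↑(P j))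
    (hex : ∀ j, dist (y j) (y i) ≤ r → ∀ m, m ≠ j → dist (y m) (y j) ≤ (3 / 2 + 1 / 450) * nearestDist y j → ∃ v ∈ P j, f j v = y m)
    (hB : ∀ z, β * ‖z‖ ≤ ‖B z‖)
    {C : List T3} (hC : C ∈ [fccL, fccNegL, hcpL, hcpAltL]) {S₁ : List T3} (hS₁ : S₁ = fccL ∨ S₁ = hcpL)
    (hT : ∀ k, dist (y k) (y i) ≤ r → ∀ (M : EuclideanSpace ℝ (Fin 3) →ₗᵢ[ℝ] EuclideanSpace ℝ (Fin 3)) (lam : T3) (τ D : ℝ),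
      Estab y A P B i k M C lam τ D → ListedBy (P k) S₁)
    {xs : List T3} (hxs : ∀ h ∈ hexL, h ∈ xs) {Q1 : List (List T3)} (hK1 : kernelOneB C xs S₁ Q1 = true) (hQ1 : ∀ Q ∈ Q1, Q = C)
    {sg : ℤ} {c₀ e₀ a₀ : T3} (hc₀ : c₀ ∈ capL C sg) (hc₀e : tsub c₀ e₀ ∈ capL C sg) (he₀ : e₀ ∈ hexL)
    (ha₀ : a₀ ∈ C) (hax : tsq (tsub a₀ c₀) = 18) (hae : tsq (tsub a₀ e₀) = 18) (hdet : tdet c₀ e₀ a₀ ≠ 0)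
    {Q2f Q2h : List (List T3)} (hK2f : kernelTwoB C sg fccL Q2f = true) (hK2h : kernelTwoB C sg hcpL Q2h = true)
    (hl2f : ∀ Q ∈ Q2f, Q.length ≤ 18) (hl2h : ∀ Q ∈ Q2h, Q.length ≤ 18)
    {p : T3} {j₁ j₂ : Fin N} {M₁ M₂ : EuclideanSpace ℝ (Fin 3) →ₗᵢ[ℝ] EuclideanSpace ℝ (Fin 3)} {τ D ν ν' : ℝ}
    (hj₁ : dist (y j₁) (y i) ≤ r) (hν₁ : ν ≤ nearestDist y j₁) (hν₁' : nearestDist y j₁ ≤ ν') (hE₁ : Estab y A P B i j₁ M₁ C p τ D)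
    (hj₂ : dist (y j₂) (y i) ≤ r) (hν₂ : ν ≤ nearestDist y j₂) (hν₂' : nearestDist y j₂ ≤ ν')
    (hE₂ : Estab y A P B i j₂ M₂ C (tadd p e₀) τ D)
    (hΔ : 2 * D + 1 / 10 ^ 4 * ν' + τ < ν) (hsmall : (2 * τ + 5 / 2 * (3 / 10 ^ 4 * ν')) * Real.sqrt 2 < β)
    (hΔk : 2 * D + 2 / 10 ^ 4 * ν' + 2 * τ < 9967 / 10000 * ν)
    (hroom : ‖B (mv (tadd p c₀))‖ + (D + 1 / 10 ^ 4 * ν' + τ) ≤ r) :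
    ∃ k : Fin N, ∃ M : EuclideanSpace ℝ (Fin 3) →ₗᵢ[ℝ] EuclideanSpace ℝ (Fin 3), ∃ Q : List T3,
      dist (y k) (y i) ≤ r ∧ 9967 / 10000 * ν ≤ nearestDist y k ∧ nearestDist y k ≤ 10011 / 10000 * ν' ∧
      ((P k = fccTwoShellPattern ∧ Q ∈ Q2f) ∨ (P k = hcpTwoShellPattern ∧ Q ∈ Q2h)) ∧
      Estab y A P B i k M Q (tadd p c₀) (τ + 5 / 2 * (2 * (1 / 10 ^ 4) * ν' + 1 / 10 ^ 4 * (10011 / 10000 * ν'))) (D + 1 / 10 ^ 4 * ν' + τ) := by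
  obtain ⟨hClen, hhexC⟩ := copies_basic C hC
  have hsep := copies_separated C hC
  obtain ⟨-, he₀18⟩ := hexL_facts e₀ he₀
  have hed : tsub (tadd p e₀) p = e₀ := tsub_tadd_self p e₀
  have hq1 : tsub (tadd p c₀) p = c₀ := tsub_tadd_self p c₀
  have hq2 : tsub (tadd p c₀) (tadd p e₀) = tsub c₀ e₀ := tsub_tadd_tadd_left p c₀ e₀
  have hL₂ : ListedBy (P j₂) S₁ := hT j₂ hj₂ M₂ _ _ _ hE₂
  have hτ0 : 0 ≤ τ := link_nonneg hE₁.2.1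
  have c1 : (D + 1 / 10 ^ 4 * nearestDist y j₁ + τ) + D < nearestDist y j₂ := by linarith
  have c2 : (τ + 5 / 2 * (2 * (1 / 10 ^ 4) * nearestDist y j₁ + 1 / 10 ^ 4 * nearestDist y j₂) + τ) * Real.sqrt 2 < β := by
    have h1 : τ + 5 / 2 * (2 * (1 / 10 ^ 4) * nearestDist y j₁ + 1 / 10 ^ 4 * nearestDist y j₂) + τ ≤ 2 * τ + 5 / 2 * (3 / 10 ^ 4 * ν') := by
      linarith
    have h2 := mul_le_mul_of_nonneg_right h1 (Real.sqrt_nonneg 2)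
    linarith
  have c3 : (D + 1 / 10 ^ 4 * nearestDist y j₁ + τ) + (D + 1 / 10 ^ 4 * nearestDist y j₂ + τ) < 9967 / 10000 * nearestDist y j₁ := by linarith
  have c4 : ‖B (mv (tadd p c₀))‖ + (D + 1 / 10 ^ 4 * nearestDist y j₁ + τ) ≤ r := by linarith
  obtain ⟨k, v, -, -, -, -, hkr, hsc, hsc', R₁, -, Q, hQ, hEk⟩ :=
    estab_child_two hy hP hA hf hinj hex hj₁ hj₂ hB hE₁ hE₂ hsep hClen (by rw [hed]; exact hhexC e₀ he₀) (by rw [hed]; exact he₀18)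
      (xs := xs) (by rw [hed]; exact hxs e₀ he₀) hS₁ hL₂ hK1 hQ1 c1 c2
      (q := tadd p c₀) (sg := sg) (by rw [hq1]; exact hc₀) (by rw [hq2]; exact hc₀e)
      (a := a₀) ha₀ (by rw [hq1]; exact hax) (by rw [hed]; exact hae) (by rw [hq1, hed]; exact hdet) hK2f hK2h hl2f hl2h c3 c4
  refine ⟨k, M₁.comp R₁, Q, hkr, by linarith, by linarith, hQ, estab_mono hEk ?_ ?_⟩
  · have h : nearestDist y k ≤ 10011 / 10000 * ν' := by linarith
    linarith
  · linarith

/-! ## §2  Cap tables -/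

/-- **Shape of the caps.**  On either side `s = ±1` the caps of every aligned copy are `capv s ε δ, δ ∈ dL` for one sign `ε`. [this file] -/
theorem cap_shape : ∀ C ∈ [fccL, fccNegL, hcpL, hcpAltL], ∀ s ∈ [(1 : ℤ), -1],
    (∀ δ ∈ dL, capv s 1 δ ∈ capL C s) ∨ (∀ δ ∈ dL, capv s (-1) δ ∈ capL C s) := by decide

/-- **Cap pairs.**  For distinct `δa, δb ∈ dL`: `e := capv s ε δa − capv s ε δb ∈ hexL`, and some in-plane `a ∈ hexL` is adjacent to the cap
`capv s ε δa` and to `e` with `tdet ≠ 0` (the rigid-triple input of `climb_point`). [this file] -/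
theorem cap_pairs : ∀ s ∈ [(1 : ℤ), -1], ∀ ε ∈ [(1 : ℤ), -1], ∀ δa ∈ dL, ∀ δb ∈ dL, δa ≠ δb →
    tsub (capv s ε δa) (capv s ε δb) ∈ hexL ∧ ∃ a ∈ hexL, tsq (tsub a (capv s ε δa)) = 18 ∧
      tsq (tsub a (tsub (capv s ε δa) (capv s ε δb))) = 18 ∧ tdet (capv s ε δa) (tsub (capv s ε δa) (capv s ε δb)) a ≠ 0 := by decide

/-- `±1` as list membership. [this file] -/
theorem mem_signs {s : ℤ} (hs : s = 1 ∨ s = -1) : s ∈ [(1 : ℤ), -1] := by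
  rcases hs with rfl | rfl <;> simp

/-- Differences of caps of one side are layer vectors. [this file] -/
theorem dL_diff : ∀ δ ∈ dL, ∀ δ' ∈ dL, (3 : ℤ) ∣ (δ.1 - δ'.1) ∧ (3 : ℤ) ∣ (δ.2.1 - δ'.2.1) ∧
    (δ.1 - δ'.1) + (δ.2.1 - δ'.2.1) + (δ.2.2 - δ'.2.2) = 0 := by decide

/-- `capv s ε δ − capv s ε δ′` lies on the layer lattice (`ε = ±1`, `δ, δ′ ∈ dL`). [this file] -/
theorem inLayer_capv_sub {s ε : ℤ} (hε : ε = 1 ∨ ε = -1) {δ δ' : T3} (hδ : δ ∈ dL) (hδ' : δ' ∈ dL) :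
    InLayer (tsub (capv s ε δ) (capv s ε δ')) := by
  obtain ⟨h1, h2, h3⟩ := dL_diff δ hδ δ' hδ'
  simp only [InLayer, capv, tsub]
  rcases hε with rfl | rfl
  · exact ⟨by omega, by omega, by omega⟩
  · exact ⟨by omega, by omega, by omega⟩

/-! ## §3  One layer up or down on a box -/

/-- ★★ **BOX CLIMB (edge-supported growth).**  Ball data at base `i`; aligned copy `C` with listing model, in-layer row and two-parent rows as in
`climb_point`; side `sg = ±1` and cap sign `ε = ±1` with `capv sg ε δ ∈ capL C sg` for `δ ∈ dL` (`cap_shape`); parents established on `C` at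
labels `λ₀ + z` over the box `InBox o K` (`K ≥ 2`, `o` sum-zero) with bounds `τ, D`, scales in `[ν, ν′]`; the three resolution inequalities; ROOM on
the child box.  Output: every layer vector `x` of the box `InBox (o + ε·(1,1,−2)) (K − 1)` labels an established child at `λ₀ + capv sg ε (1,1,−2) + x`
(bounds `τ⁺, D⁺`, scales in `[0.9967ν, 1.0011ν′]`, copy from the row of its type).  Proof: in the child's column coordinates `t = x + o + ε(1,1,−2)`
at most one coordinate reaches `±(K − 1)`; the cap pair avoiding it has both parents in the box (`climb_point`). [this file] -/
theorem layer_climb_box {y : Fin N → EuclideanSpace ℝ (Fin 3)} (hy : Function.Injective y) {r : ℝ} {i : Fin N}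
    {A : Fin N → (EuclideanSpace ℝ (Fin 3) →ₗ[ℝ] EuclideanSpace ℝ (Fin 3))} {Qf : Fin N → (EuclideanSpace ℝ (Fin 3) →ₗᵢ[ℝ] EuclideanSpace ℝ (Fin 3))}
    {P : Fin N → Finset (EuclideanSpace ℝ (Fin 3))} {f : Fin N → EuclideanSpace ℝ (Fin 3) → EuclideanSpace ℝ (Fin 3)}
    {B : EuclideanSpace ℝ (Fin 3) →ₗ[ℝ] EuclideanSpace ℝ (Fin 3)} {β : ℝ}
    (hP : ∀ j, dist (y j) (y i) ≤ r → (P j = fccTwoShellPattern ∨ P j = hcpTwoShellPattern))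
    (hA : ∀ j, dist (y j) (y i) ≤ r → ∀ v ∈ P j, ‖A j v - Qf j v‖ ≤ 1 / 1000)
    (hf : ∀ j, dist (y j) (y i) ≤ r → ∀ v ∈ P j, f j v ∈ Set.range y ∧ dist (f j v) (y j + nearestDist y j • A j v) ≤ 1 / 10 ^ 4 * nearestDist y j)
    (hinj : ∀ j, dist (y j) (y i) ≤ r → Set.InjOn (f j) ↑(P j))
    (hex : ∀ j, dist (y j) (y i) ≤ r → ∀ m, m ≠ j → dist (y m) (y j) ≤ (3 / 2 + 1 / 450) * nearestDist y j → ∃ v ∈ P j, f j v = y m)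
    (hB : ∀ z, β * ‖z‖ ≤ ‖B z‖)
    {C : List T3} (hC : C ∈ [fccL, fccNegL, hcpL, hcpAltL]) {S₁ : List T3} (hS₁ : S₁ = fccL ∨ S₁ = hcpL)
    (hT : ∀ k, dist (y k) (y i) ≤ r → ∀ (M : EuclideanSpace ℝ (Fin 3) →ₗᵢ[ℝ] EuclideanSpace ℝ (Fin 3)) (lam : T3) (τ D : ℝ),
      Estab y A P B i k M C lam τ D → ListedBy (P k) S₁)
    {xs : List T3} (hxs : ∀ h ∈ hexL, h ∈ xs) {Q1 : List (List T3)} (hK1 : kernelOneB C xs S₁ Q1 = true) (hQ1 : ∀ Q ∈ Q1, Q = C)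
    {sg ε : ℤ} (hsg : sg = 1 ∨ sg = -1) (hε : ε = 1 ∨ ε = -1) (hcaps : ∀ δ ∈ dL, capv sg ε δ ∈ capL C sg)
    {Q2f Q2h : List (List T3)} (hK2f : kernelTwoB C sg fccL Q2f = true) (hK2h : kernelTwoB C sg hcpL Q2h = true)
    (hl2f : ∀ Q ∈ Q2f, Q.length ≤ 18) (hl2h : ∀ Q ∈ Q2h, Q.length ≤ 18)
    {lam₀ o : T3} (ho : thsum o = 0) {K : ℤ} (hK : 2 ≤ K) {τ D ν ν' : ℝ}
    (hpar : ∀ z, InLayer z → InBox o K z → ∃ k : Fin N, ∃ M : EuclideanSpace ℝ (Fin 3) →ₗᵢ[ℝ] EuclideanSpace ℝ (Fin 3),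
      dist (y k) (y i) ≤ r ∧ ν ≤ nearestDist y k ∧ nearestDist y k ≤ ν' ∧ Estab y A P B i k M C (tadd lam₀ z) τ D)
    (hΔ : 2 * D + 1 / 10 ^ 4 * ν' + τ < ν) (hsmall : (2 * τ + 5 / 2 * (3 / 10 ^ 4 * ν')) * Real.sqrt 2 < β)
    (hΔk : 2 * D + 2 / 10 ^ 4 * ν' + 2 * τ < 9967 / 10000 * ν)
    (hroom : ∀ x, InLayer x → InBox (tadd o (capv 0 ε (1, 1, -2))) (K - 1) x →
      ‖B (mv (tadd (tadd lam₀ (capv sg ε (1, 1, -2))) x))‖ + (D + 1 / 10 ^ 4 * ν' + τ) ≤ r) :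
    ∀ x, InLayer x → InBox (tadd o (capv 0 ε (1, 1, -2))) (K - 1) x →
      ∃ k : Fin N, ∃ M : EuclideanSpace ℝ (Fin 3) →ₗᵢ[ℝ] EuclideanSpace ℝ (Fin 3), ∃ Q : List T3,
        dist (y k) (y i) ≤ r ∧ 9967 / 10000 * ν ≤ nearestDist y k ∧ nearestDist y k ≤ 10011 / 10000 * ν' ∧
        ((P k = fccTwoShellPattern ∧ Q ∈ Q2f) ∨ (P k = hcpTwoShellPattern ∧ Q ∈ Q2h)) ∧
        Estab y A P B i k M Q (tadd (tadd lam₀ (capv sg ε (1, 1, -2))) x)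
          (τ + 5 / 2 * (2 * (1 / 10 ^ 4) * ν' + 1 / 10 ^ 4 * (10011 / 10000 * ν'))) (D + 1 / 10 ^ 4 * ν' + τ) := by
  obtain ⟨-, hhexC⟩ := copies_basic C hC
  -- one climb from the cap pair `(δa, δb)`: parents at `λ₀ + z`, `λ₀ + z + (c_a − c_b)`, child at `λ₀ + z + c_a`
  have cp : ∀ δa δb : T3, δa ∈ dL → δb ∈ dL → δa ≠ δb → ∀ z, InLayer z → InBox o K z →
      InBox o K (tadd z (tsub (capv sg ε δa) (capv sg ε δb))) →
      ‖B (mv (tadd (tadd lam₀ z) (capv sg ε δa)))‖ + (D + 1 / 10 ^ 4 * ν' + τ) ≤ r →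
      ∃ k : Fin N, ∃ M : EuclideanSpace ℝ (Fin 3) →ₗᵢ[ℝ] EuclideanSpace ℝ (Fin 3), ∃ Q : List T3,
        dist (y k) (y i) ≤ r ∧ 9967 / 10000 * ν ≤ nearestDist y k ∧ nearestDist y k ≤ 10011 / 10000 * ν' ∧
        ((P k = fccTwoShellPattern ∧ Q ∈ Q2f) ∨ (P k = hcpTwoShellPattern ∧ Q ∈ Q2h)) ∧
        Estab y A P B i k M Q (tadd (tadd lam₀ z) (capv sg ε δa))
          (τ + 5 / 2 * (2 * (1 / 10 ^ 4) * ν' + 1 / 10 ^ 4 * (10011 / 10000 * ν'))) (D + 1 / 10 ^ 4 * ν' + τ) := by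
    intro δa δb ha hb hab z hz hbz hbz' hroomz
    obtain ⟨he, a, haH, hax, hae, hdet⟩ := cap_pairs sg (mem_signs hsg) ε (mem_signs hε) δa ha δb hb hab
    obtain ⟨j₁, M₁, hj₁, hν₁, hν₁', hE₁⟩ := hpar z hz hbz
    obtain ⟨j₂, M₂, hj₂, hν₂, hν₂', hE₂⟩ := hpar _ (inLayer_tadd hz (inLayer_capv_sub hε ha hb)) hbz'
    rw [← tadd_tadd_assoc] at hE₂
    exact climb_point hy hP hA hf hinj hex hB hC hS₁ hT hxs hK1 hQ1 (hcaps δa ha) (by rw [tsub_tsub_self]; exact hcaps δb hb) he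
      (hhexC a haH) hax hae hdet hK2f hK2h hl2f hl2h hj₁ hν₁ hν₁' hE₁ hj₂ hν₂ hν₂' hE₂ hΔ hsmall hΔk hroomz
  have d0 : ((1, 1, -2) : T3) ∈ dL := by decide
  have d1 : ((1, -2, 1) : T3) ∈ dL := by decide
  have d2 : ((-2, 1, 1) : T3) ∈ dL := by decide
  intro x hx hbox
  -- the climb re-based at the parent `z = x + (c₀ − c_a)`
  have key : ∀ δa δb : T3, δa ∈ dL → δb ∈ dL → δa ≠ δb →
      InBox o K (tadd x (tsub (capv sg ε (1, 1, -2)) (capv sg ε δa))) →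
      InBox o K (tadd (tadd x (tsub (capv sg ε (1, 1, -2)) (capv sg ε δa))) (tsub (capv sg ε δa) (capv sg ε δb))) →
      ∃ k : Fin N, ∃ M : EuclideanSpace ℝ (Fin 3) →ₗᵢ[ℝ] EuclideanSpace ℝ (Fin 3), ∃ Q : List T3,
        dist (y k) (y i) ≤ r ∧ 9967 / 10000 * ν ≤ nearestDist y k ∧ nearestDist y k ≤ 10011 / 10000 * ν' ∧
        ((P k = fccTwoShellPattern ∧ Q ∈ Q2f) ∨ (P k = hcpTwoShellPattern ∧ Q ∈ Q2h)) ∧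
        Estab y A P B i k M Q (tadd (tadd lam₀ (capv sg ε (1, 1, -2))) x)
          (τ + 5 / 2 * (2 * (1 / 10 ^ 4) * ν' + 1 / 10 ^ 4 * (10011 / 10000 * ν'))) (D + 1 / 10 ^ 4 * ν' + τ) := by
    intro δa δb ha hb hab hb1 hb2
    have hz : InLayer (tadd x (tsub (capv sg ε (1, 1, -2)) (capv sg ε δa))) := inLayer_tadd hx (inLayer_capv_sub hε d0 ha)
    have hid : tadd (tadd lam₀ (tadd x (tsub (capv sg ε (1, 1, -2)) (capv sg ε δa)))) (capv sg ε δa) =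
        tadd (tadd lam₀ (capv sg ε (1, 1, -2))) x := tadd_tadd_tsub_cancel _ _ _ _
    have h := cp δa δb ha hb hab _ hz hb1 hb2 (by rw [hid]; exact hroom x hx hbox)
    rw [hid] at h
    exact h
  have hx0 := hx.1
  simp only [thsum] at ho
  -- case analysis on the (at most one) extreme child coordinate
  rcases hε with rfl | rfl
  · by_cases h1 : K - 1 ≤ x.1 + o.1 + 1
    · exact key _ _ d0 d1 (by decide) (by simp only [InBox, tadd, tsub, capv, abs_le] at hbox ⊢; omega)
        (by simp only [InBox, tadd, tsub, capv, abs_le] at hbox ⊢; omega)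
    · by_cases h2 : K - 1 ≤ x.2.1 + o.2.1 + 1
      · exact key _ _ d0 d2 (by decide) (by simp only [InBox, tadd, tsub, capv, abs_le] at hbox ⊢; omega)
          (by simp only [InBox, tadd, tsub, capv, abs_le] at hbox ⊢; omega)
      · exact key _ _ d1 d2 (by decide) (by simp only [InBox, tadd, tsub, capv, abs_le] at hbox ⊢; omega)
          (by simp only [InBox, tadd, tsub, capv, abs_le] at hbox ⊢; omega)
  · by_cases h1 : x.1 + o.1 - 1 ≤ 1 - K
    · exact key _ _ d0 d1 (by decide) (by simp only [InBox, tadd, tsub, capv, abs_le] at hbox ⊢; omega)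
        (by simp only [InBox, tadd, tsub, capv, abs_le] at hbox ⊢; omega)
    · by_cases h2 : x.2.1 + o.2.1 - 1 ≤ 1 - K
      · exact key _ _ d0 d2 (by decide) (by simp only [InBox, tadd, tsub, capv, abs_le] at hbox ⊢; omega)
          (by simp only [InBox, tadd, tsub, capv, abs_le] at hbox ⊢; omega)
      · exact key _ _ d1 d2 (by decide) (by simp only [InBox, tadd, tsub, capv, abs_le] at hbox ⊢; omega)
          (by simp only [InBox, tadd, tsub, capv, abs_le] at hbox ⊢; omega)

end Summit.AtomisticToContinuum.Crystallization.Theorems.OverbindingBudgetAffineCompressedCutPatch
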